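import Literature.MathematicalPhysics.QuantumFieldTheory.Balaban1983to89.Node00.WorldFrame

/-!
# YM-DAG node N13 · [Balaban1989LargeFieldII] — the (2.50) EXPONENT FUNCTIONS `em, ep` of a binding world are read by N13 ALONE: the twelve other
# paper nodes are invariant under re-pinning them, N13 with free exponents is JUNK-REFUTABLE at every record that does not pin them, and the
# QUANTIFIED N13 shape «∃ e₋ e₊, N13 at the world re-read with (e₋, e₊)» still closes binder B2 (`B16.EndStatementBPrinted w.C`) with N01–N12

TRACK-A SEAT FILE (seat `pub-ymgap-dag-n13-a`, KNIT-BY-NAME for N13; kernel input to NODE 00's Stage-5 design — `STAGE5-SCOPING-g28.md` §4: *«S_BetaSide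
and S_N13 read FREE world scalars (`w.em w.ep`) ⇒ junk-refutable at EVERY stage unless the child quantifies them»* — and to this seat's `N13-PIN-LIST.md`
row R16).  THEOREMS ONLY; imports `Node00.WorldFrame` (hence `DagBinding`) only.
WHAT IS HERE.  §1 `nodes12_iff_withExp`: N01–N12 at a run do not read `w.em`, `w.ep` — at the world `{ w with em := e₋, ep := e₊ }` they are the SAME
propositions (`Iff.rfl`); `nodes_withExp_of`: the thirteen-node conjunction `DagBinding.Nodes` at the re-read world from N01–N12 at `w` and N13 at the
re-read world.  §2 `endStatementBPrinted_of_nodes12_of_exists_exponents`: the END headline `DagBinding.endStatementBPrinted_of_nodesP_interval` survives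
the QUANTIFIED reading of N13 — if N01–N12 hold at every run of `w`, SOME pair of exponent functions `(e₋, e₊)` makes N13 hold at every run of the re-read
world, the couplings satisfy (0.20) and the β-window holds, then `B16.EndStatementBPrinted w.C` ([Balaban1989LargeFieldII] Thm 1 ∧ [III] Cor. 3, binder B2):
Cor. 3's printed quantifier *«there exist constants E₋, E₊ … depending on g_k»* ([Balaban1988Convergent] p. 264) is an ∃ over dependence functions, so
N13's stub may carry that ∃ itself instead of reading pinned world fields.  §3 `exists_ep_not_b16_main`: conversely, at ANY world and run where N13's
in-edge antecedents hold, the interval hypothesis holds and some density value `ρ_k(V) > 0` sits on a non-empty lattice, re-pinning `ep` alone FALSIFIES N13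
— so a per-node stub `∀ w, Rec w → ∀ P, Dag.B16_main (leavesP w P)` over a record predicate `Rec` that does not pin (or quantify) the exponents is
refutable by junk exponents, whatever else `Rec` pins (the kernel form of the §4 warning; the repair is R16 = pin `em, ep` in the record, or the
quantified shape of §2).
HONEST FRAMING: pure-logic bookkeeping over `Dag` ∕ `DagBinding`; nothing of Bałaban's asserted; N13 ∕ B2 NOT discharged; one finite T⁴ programme at fixed
ε; NOT ℝ⁴ ∕ infinite volume ∕ OS ∕ mass gap ∕ Clay.
-/

noncomputable section

namespace Literature.MathematicalPhysics.QuantumFieldTheory.Balaban1983to89.B16NodeKnitExponents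

open DagBinding

/-! ## §1. Only N13 reads the exponent functions -/

section Invariance

variable (w : WorldP) (em ep : ℝ → ℝ) (P : B12.RunParams)

/-- **N01–N12 at a run are the same propositions at the world re-read with ANY exponent functions `(e₋, e₊)`** (`Iff.rfl`: of the 22 leaves of
`DagBinding.leavesP` only `uvBounds` mentions `w.em`, `w.ep`, and only `Dag.B16_main` mentions `uvBounds`). [cite: Balaban1988Convergent, Cor. 3 (2.50) p.264 (the exponents enter the end statement only; bookkeeping)] -/
theorem nodes12_iff_withExp :
    (Dag.B4_main (leavesP { w with em := em, ep := ep } P) ↔ Dag.B4_main (leavesP w P)) ∧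
    (Dag.B5_main (leavesP { w with em := em, ep := ep } P) ↔ Dag.B5_main (leavesP w P)) ∧
    (Dag.B6_main (leavesP { w with em := em, ep := ep } P) ↔ Dag.B6_main (leavesP w P)) ∧
    (Dag.B7_main (leavesP { w with em := em, ep := ep } P) ↔ Dag.B7_main (leavesP w P)) ∧
    (Dag.B8_main (leavesP { w with em := em, ep := ep } P) ↔ Dag.B8_main (leavesP w P)) ∧
    (Dag.B9_main (leavesP { w with em := em, ep := ep } P) ↔ Dag.B9_main (leavesP w P)) ∧
    (Dag.B10_main (leavesP { w with em := em, ep := ep } P) ↔ Dag.B10_main (leavesP w P)) ∧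
    (Dag.B11_main (leavesP { w with em := em, ep := ep } P) ↔ Dag.B11_main (leavesP w P)) ∧
    (Dag.B12_main (leavesP { w with em := em, ep := ep } P) ↔ Dag.B12_main (leavesP w P)) ∧
    (Dag.B13_main (leavesP { w with em := em, ep := ep } P) ↔ Dag.B13_main (leavesP w P)) ∧
    (Dag.B14_main (leavesP { w with em := em, ep := ep } P) ↔ Dag.B14_main (leavesP w P)) ∧
    (Dag.B15_main (leavesP { w with em := em, ep := ep } P) ↔ Dag.B15_main (leavesP w P)) :=
  ⟨Iff.rfl, Iff.rfl, Iff.rfl, Iff.rfl, Iff.rfl, Iff.rfl, Iff.rfl, Iff.rfl, Iff.rfl, Iff.rfl, Iff.rfl, Iff.rfl⟩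

/-- N13 at the re-read world, unfolded: the node at `w` with `(w.em, w.ep)` replaced by `(e₋, e₊)` in the (2.50) family and NOTHING else changed.
[cite: Balaban1989LargeFieldII, Thm 1 and (0.1) p.355 (bookkeeping)] -/
theorem b16_main_withExp_iff :
    Dag.B16_main (leavesP { w with em := em, ep := ep } P) ↔
      ((w.up P).b5 → (w.up P).b6 → (w.up P).b7 → (w.up P).b9 → (w.up P).b10 → (w.up P).b11 → (w.up P).b13 →
        (w.up P).rBasicStep →
          ((w.C P).flow.InInterval w.γ P.K → ∀ k, k ≤ P.K → (w.C P).IndAss k) →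
            ((w.up P).rOperation ∧
              (((w.C P).flow.InInterval w.γ P.K → ∀ k, k ≤ P.K → (w.C P).Sect2Form k) →
                ((w.C P).flow.InInterval w.γ P.K → ∀ k, k ≤ P.K → ∀ V : (w.C P).Cfg k,
                  B16.UVIneq (w.C P) k V (em ((w.C P).flow.g k)) (ep ((w.C P).flow.g k)))))) :=
  Iff.rfl

variable {w em ep P}

/-- **The thirteen-node conjunction at the re-read world from N01–N12 at `w` and N13 at the re-read world.** [cite: Balaban1989LargeFieldII, Thm 1 p.355 (bookkeeping)] -/
theorem nodes_withExp_of (h4 : Dag.B4_main (leavesP w P)) (h5 : Dag.B5_main (leavesP w P)) (h6 : Dag.B6_main (leavesP w P))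
    (h7 : Dag.B7_main (leavesP w P)) (h8 : Dag.B8_main (leavesP w P)) (h9 : Dag.B9_main (leavesP w P))
    (h10 : Dag.B10_main (leavesP w P)) (h11 : Dag.B11_main (leavesP w P)) (h12 : Dag.B12_main (leavesP w P))
    (h13 : Dag.B13_main (leavesP w P)) (h14 : Dag.B14_main (leavesP w P)) (h15 : Dag.B15_main (leavesP w P))
    (h16 : Dag.B16_main (leavesP { w with em := em, ep := ep } P)) :
    Nodes (leavesP { w with em := em, ep := ep } P) :=
  ⟨h4, h5, h6, h7, h8, h9, h10, h11, h12, h13, h14, h15, h16⟩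

end Invariance

/-! ## §2. The END headline with N13 in the QUANTIFIED reading «∃ (e₋, e₊)» -/

section Quantified

variable (w : WorldP)

/-- **Binder B2 from N01–N12 at the world and N13 for SOME exponent functions.**  If `0 < w.γ ≤ γ₀`, the twelve nodes N01–N12 hold at every run of
`w`, there EXIST dependence functions `(e₋, e₊)` for which N13 holds at every run of the re-read world, the couplings satisfy (0.20) along every run
and the β-window `b ≤ β ≤ β⁺` holds on `]0, γ₀]` (faithful form `DagBinding.BetaBoundsInInterval`), then the PIN `B16.EndStatementBPrinted w.C` —
[Balaban1989LargeFieldII] Thm 1 ∧ [Balaban1988Convergent] Cor. 3 (2.50), whose printed quantifier *«there exist constants E₋, E₊ independent of η and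
T, but depending on g_k»* is exactly this ∃ — holds, by `DagBinding.endStatementBPrinted_of_nodesP_interval` at the re-read world (same `C`, `γ`, `b`,
`βup`, `up`).  So the N13 stub may be typed `∀ w, Rec w → ∃ e₋ e₊, ∀ P, Dag.B16_main (leavesP {w with em := e₋, ep := e₊} P)` without loss for B2.
Pure logic. [cite: Balaban1989LargeFieldII, Thm 1 p.355 + p.391; Balaban1988Convergent, Cor. 3 (2.50) p.264] -/
theorem endStatementBPrinted_of_nodes12_of_exists_exponents (hγ : 0 < w.γ) {γ₀ : ℝ} (hγ₀ : w.γ ≤ γ₀)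
    (h12 : ∀ P : B12.RunParams,
      Dag.B4_main (leavesP w P) ∧ Dag.B5_main (leavesP w P) ∧ Dag.B6_main (leavesP w P) ∧ Dag.B7_main (leavesP w P) ∧
      Dag.B8_main (leavesP w P) ∧ Dag.B9_main (leavesP w P) ∧ Dag.B10_main (leavesP w P) ∧ Dag.B11_main (leavesP w P) ∧
      Dag.B12_main (leavesP w P) ∧ Dag.B13_main (leavesP w P) ∧ Dag.B14_main (leavesP w P) ∧ Dag.B15_main (leavesP w P))
    (h13 : ∃ em ep : ℝ → ℝ, ∀ P : B12.RunParams, Dag.B16_main (leavesP { w with em := em, ep := ep } P))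
    (hrg : ∀ P : B12.RunParams, (leavesP w P).rgFlow) (hβ : BetaBoundsInInterval w.C.toB12 γ₀ w.b w.βup) :
    B16.EndStatementBPrinted w.C := by
  obtain ⟨em, ep, h16⟩ := h13
  have h := endStatementBPrinted_of_nodesP_interval { w with em := em, ep := ep } hγ hγ₀ (fun P => ?_) hrg hβ
  · exact h
  · obtain ⟨h4, h5, h6, h7, h8, h9, h10, h11, h12', h13', h14, h15⟩ := h12 P
    exact nodes_withExp_of h4 h5 h6 h7 h8 h9 h10 h11 h12' h13' h14 h15 (h16 P)

/-- The same over an ARBITRARY record predicate (the `S_N13`-quantified shape): if every `IsRec`-world has `0 < γ ≤ γ₀`, carries N01–N12 at every run,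
N13 for SOME exponents at every run of the re-read world, (0.20) and the β-window, then B2 holds at every `IsRec`-world.
[cite: Balaban1989LargeFieldII, Thm 1 p.355 + p.391 (bookkeeping: the quantified stub closes the binder)] -/
theorem atRecord_endStatementBPrinted_of_N13_exists {IsRec : WorldP → Prop} {γ₀ : ℝ}
    (hγ : ∀ w, IsRec w → 0 < w.γ ∧ w.γ ≤ γ₀)
    (h12 : ∀ w, IsRec w → ∀ P : B12.RunParams,
      Dag.B4_main (leavesP w P) ∧ Dag.B5_main (leavesP w P) ∧ Dag.B6_main (leavesP w P) ∧ Dag.B7_main (leavesP w P) ∧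
      Dag.B8_main (leavesP w P) ∧ Dag.B9_main (leavesP w P) ∧ Dag.B10_main (leavesP w P) ∧ Dag.B11_main (leavesP w P) ∧
      Dag.B12_main (leavesP w P) ∧ Dag.B13_main (leavesP w P) ∧ Dag.B14_main (leavesP w P) ∧ Dag.B15_main (leavesP w P))
    (h13 : ∀ w, IsRec w → ∃ em ep : ℝ → ℝ, ∀ P : B12.RunParams, Dag.B16_main (leavesP { w with em := em, ep := ep } P))
    (hrg : ∀ w, IsRec w → ∀ P : B12.RunParams, (leavesP w P).rgFlow)
    (hβ : ∀ w, IsRec w → BetaBoundsInInterval w.C.toB12 γ₀ w.b w.βup) :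
    ∀ w, IsRec w → B16.EndStatementBPrinted w.C :=
  fun w hw => endStatementBPrinted_of_nodes12_of_exists_exponents w (hγ w hw).1 (hγ w hw).2 (h12 w hw) (h13 w hw) (hrg w hw) (hβ w hw)

end Quantified

/-! ## §3. N13 with FREE exponents is junk-refutable at every record that does not pin them -/

section Junk

variable (w : WorldP) (P : B12.RunParams)

/-- **Re-pinning `ep` alone falsifies N13** at any world and run where: N13's nine in-edge antecedents hold (so the implication is not vacuously true),
the interval hypothesis holds, and some density value is POSITIVE on a non-empty lattice (`0 < ρ_k(V)`, `0 < |T_η|`, `k ≤ K`) — as at any record of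
Bałaban's densities.  Witness: the constant function `e₊ ≡ (log ρ_k(V) − 1) ∕ |T_η|`, for which the upper half of (2.50) reads `ρ_k(V) ≤ ρ_k(V)∕e`.  Hence a stub
`∀ w, Rec w → ∀ P, Dag.B16_main (leavesP w P)` over a record predicate closed under re-pinning `ep` is FALSE as soon as one `Rec`-world has such a run:
the exponents must be pinned in the record (N13-PIN-LIST R16) or quantified in the stub (§2).  Pure logic + `Real.exp_log`.
[cite: Balaban1988Convergent, Cor. 3 (2.50) p.264 (bookkeeping: the exponents are load-bearing data of the statement)] -/
theorem exists_ep_not_b16_main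
    (h5 : (w.up P).b5) (h6 : (w.up P).b6) (h7 : (w.up P).b7) (h9 : (w.up P).b9) (h10 : (w.up P).b10) (h11 : (w.up P).b11)
    (h13 : (w.up P).b13) (h15 : (w.up P).rBasicStep)
    (hsf : (w.C P).flow.InInterval w.γ P.K → ∀ k, k ≤ P.K → (w.C P).IndAss k)
    (hdd : (w.C P).flow.InInterval w.γ P.K → ∀ k, k ≤ P.K → (w.C P).Sect2Form k)
    (hsc : (w.C P).flow.InInterval w.γ P.K)
    {k : ℕ} (hk : k ≤ P.K) (V : (w.C P).Cfg k) (hρ : 0 < (w.C P).ρ k V) (hN : 0 < (w.C P).numSites k) :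
    ∃ ep : ℝ → ℝ, ¬ Dag.B16_main (leavesP { w with ep := ep } P) := by
  refine ⟨fun _ => (Real.log ((w.C P).ρ k V) - 1) / ((w.C P).numSites k : ℝ), fun h => ?_⟩
  have hN' : (0 : ℝ) < ((w.C P).numSites k : ℝ) := by exact_mod_cast hN
  have hup := ((h h5 h6 h7 h9 h10 h11 h13 h15 hsf).2 hdd hsc k hk V).2
  have heq : (Real.log ((w.C P).ρ k V) - 1) / ((w.C P).numSites k : ℝ) * ((w.C P).numSites k : ℝ) =
      Real.log ((w.C P).ρ k V) - 1 := div_mul_cancel₀ _ hN'.ne'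
  have hlt : Real.exp ((Real.log ((w.C P).ρ k V) - 1) / ((w.C P).numSites k : ℝ) * ((w.C P).numSites k : ℝ)) < (w.C P).ρ k V := by
    rw [heq]
    calc Real.exp (Real.log ((w.C P).ρ k V) - 1) < Real.exp (Real.log ((w.C P).ρ k V)) :=
          Real.exp_lt_exp.mpr (by linarith)
      _ = (w.C P).ρ k V := Real.exp_log hρ
  exact absurd hup (not_le.mpr hlt)

/-- The same refutation read as a statement about STUBS: if a predicate `IsRec` on binding worlds is closed under re-pinning `ep` and holds at some world
with such a run (antecedents, interval hypothesis, a positive density value on a non-empty lattice), then the UNQUANTIFIED N13 stub over `IsRec` is false.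
[cite: Balaban1988Convergent, Cor. 3 (2.50) p.264 (bookkeeping: which record predicates make the per-node stub meaningful)] -/
theorem not_atRecord_b16_main_of_ep_free {IsRec : WorldP → Prop}
    (hclosed : ∀ w, IsRec w → ∀ ep : ℝ → ℝ, IsRec { w with ep := ep })
    (hex : ∃ w, IsRec w ∧ ∃ P : B12.RunParams,
      (w.up P).b5 ∧ (w.up P).b6 ∧ (w.up P).b7 ∧ (w.up P).b9 ∧ (w.up P).b10 ∧ (w.up P).b11 ∧ (w.up P).b13 ∧ (w.up P).rBasicStep ∧
      ((w.C P).flow.InInterval w.γ P.K → ∀ k, k ≤ P.K → (w.C P).IndAss k) ∧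
      ((w.C P).flow.InInterval w.γ P.K → ∀ k, k ≤ P.K → (w.C P).Sect2Form k) ∧
      (w.C P).flow.InInterval w.γ P.K ∧
      ∃ k, k ≤ P.K ∧ ∃ V : (w.C P).Cfg k, 0 < (w.C P).ρ k V ∧ 0 < (w.C P).numSites k) :
    ¬ (∀ w, IsRec w → ∀ P : B12.RunParams, Dag.B16_main (leavesP w P)) := by
  intro hstub
  obtain ⟨w, hw, P, h5, h6, h7, h9, h10, h11, h13, h15, hsf, hdd, hsc, k, hk, V, hρ, hN⟩ := hex
  obtain ⟨ep, hnot⟩ := exists_ep_not_b16_main w P h5 h6 h7 h9 h10 h11 h13 h15 hsf hdd hsc hk V hρ hN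
  exact hnot (hstub _ (hclosed w hw ep) P)

end Junk

end Literature.MathematicalPhysics.QuantumFieldTheory.Balaban1983to89.B16NodeKnitExponents

end
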